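import Summits.BirchSwinnertonDyer.Rank1Residual.X11a.PrintDischargeEulerHalf
import Summits.BirchSwinnertonDyer.Rank1Residual.X11b.BDPRouteTamagawaSupport
import Literature.NumberTheory.EllipticCurves.SkinnerUrban2014.PAdicUnitPeriodRatioProofs
import Literature.NumberTheory.EllipticCurves.Rank1Residual.PeriodUnitProofs
import Literature.NumberTheory.EllipticCurves.KuriharaNumber
import Literature.NumberTheory.EllipticCurves.LeadingTermPPartProofs
import Literature.NumberTheory.EllipticCurves.Wuthrich2014.ShaBoundProofs
import Literature.NumberTheory.EllipticCurves.AnalyticRankModularityProofs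
import HarnessLib

/-!
# Crux U5 `PrintX11a.UpperNonSurjFive` (item stmt-BirchSwinnertonDyer-20614), line «gl1cartan5», stub I:
# `ShaAnIntegral` — `p`-integrality of `#Ш(E/ℚ)_an` on X11a at `p ≥ 5` with no split multiplicative prime —
# from THREE EXISTING named facts (modularity, Mazur 1978 Cor. 4.1, Gross–Zagier–Kolyvagin); theorems only

HONEST FRAMING. BSD is not proved by any of this; nothing is asserted about any curve. Theorems only: no
definition, no named fact minted, no `sorry`. The line's stub I (`Cruxes.UpperNonSurjFive.GL1Cartan.stub_shaAnIntegral :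
ShaAnIntegral`) is a PRINT input; this file proves its statement (unfolded verbatim) from named facts ALREADY in
the tree, so that the lead can reshape the stub to «named facts BY NAME → ShaAnIntegral».

WHAT. `ShaAnIntegral`: at an X11a pair `(W, p)` (`r_an = 0`, `p` odd, `p ∥ N`, `E[p]` irreducible, no (ram)
witness) with `5 ≤ p` and NO split multiplicative prime, Miller's analytic order of Ш
`#Ш_an = L(E,1)·#E(ℚ)_tors² / (Ω_E · ∏ c_ℓ · Reg)` (`shaAn W`) is a rational number `q` with `0 ≤ ord_p q`.
The brief proposed to type Wuthrich 2014 Thm. 1 / Cor. 7 (`[0]⁺_{E•} ∈ ℤ_(p)` for a curve `E•` of the isogeny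
class at an odd semistable `p`) plus the transfer inside a `p′`-isogeny class. SEARCH FOUND that the tree already
carries the whole road in the `Ω⁺_f`-normalisation, so NO new fact is typed:
* `L(E,1) = [0]⁺_f · Ω⁺_f` for the newform `f` of `E` (THEOREM `IsNewformOf.entireLFunction_one_eq`,
  `LeadingTermPPartProofs`; MTT §I.8) — `f` from the named fact `exists_isNewformOf` (Modularity, BCDT 2001 Thm. A
  / Diamond–Shurman Thm. 8.8.3, hypothesis `hnf`);
* `‖[0]⁺_f‖_p ≤ 1` for `p` odd and `E[p]` irreducible (THEOREM `IsNewformOf.norm_ratPlusSymbol_le_one`,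
  `KuriharaNumber.lean`: an Eisenstein multiple `(a_ℓ − ℓ − 1){∞,0}_f ∈ Λ_f` with `p ∤ a_ℓ − ℓ − 1`, Chebotarev +
  Brauer–Nesbitt; unconditional in the tree);
* `Ω_E = u · Ω⁺_f`, `u ∈ ℚ`, `|u|_p = 1` at a MULTIPLICATIVE `p ≥ 5` with `E[p]` irreducible (named fact
  `realPeriodRat_eq_unit_mul_plusPeriod_of_multiplicative`, Greenberg–Vatsal 2000 Rem. 3.4), itself a THEOREM of
  the tree from Mazur 1978 Cor. 4.1 (`realPeriodRat_eq_unit_mul_plusPeriod_of_multiplicative_of_mazur`,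
  `SkinnerUrban2014/PAdicUnitPeriodRatioProofs`; hypothesis `hMz : mazur_not_dvd_maninConstant_of_odd`) — this is
  exactly the «Néron lattices in a `p′`-isogeny class differ by `p′`-indices» transfer of the brief, already proved;
* `#Ш_an = (L(E,1)/Ω_E) · #E(ℚ)² / ∏ c_ℓ` in analytic rank `0` (THEOREM `Wuthrich2014.shaAn_eq_of_L_one_div_eq`;
  `Reg = 1`, `E(ℚ)` finite by Gross–Zagier–Kolyvagin, hypothesis `hGZK` = the line's stub F by name);
* `p ∤ ∏ c_ℓ` for `p ≥ 5` when no split multiplicative prime `ℓ` has `p ∣ ord_ℓ Δ_min` — vacuous here, there is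
  no split multiplicative prime at all (THEOREM `X11b.not_dvd_tamagawaProduct_of_forall_split`, Kodaira–Néron
  `c_ℓ ≤ 4` off split multiplicative reduction).
Hence `ord_p #Ш_an = ord_p [0]⁺_f − ord_p u + 2·ord_p #E(ℚ) − ord_p ∏ c_ℓ = ord_p [0]⁺_f + 2·ord_p #E(ℚ) ≥ 0`
(the torsion sits in the NUMERATOR, so `p ∤ #E(ℚ)_tors` is not even needed).

* §1 `padicValRat_nonneg_of_norm_ratCast_le_one` — arithmetic helper.
* §2 `ClassX11a.exists_LOne_div_realPeriod_eq_of_mazur` — on X11a at `p ≥ 5`: `L(E,1)/Ω_E = t ∈ ℚ`, `t ≠ 0`,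
  `0 ≤ ord_p t` (modularity + Mazur; per pair); `exists_shaAn_eq_padicValRat_nonneg_of_LOne_div` — class-free:
  such a `t`, `p ≥ 5`, no split multiplicative prime, GZK ⟹ `#Ш_an = q`, `0 ≤ ord_p q`.
* §3 `Theorems.GL1Cartan.shaAnIntegral_of_mazur : exists_isNewformOf → mazur_not_dvd_maninConstant_of_odd →
  rank_eq_analyticRank_of_analyticRank_le_one → «ShaAnIntegral unfolded verbatim»` — the bridge; and the variant
  `shaAnIntegral_of_periodUnit` taking the Greenberg–Vatsal comparison `realPeriodRat_eq_unit_mul_plusPeriod_of_multiplicative`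
  instead of Mazur (Mazur ⟹ Greenberg–Vatsal is the tree theorem
  `SkinnerUrban2014.realPeriodRat_eq_unit_mul_plusPeriod_of_multiplicative_of_mazur`).

beyond-print theorem: NO (re-plumbing of landed theorems and three existing named facts).

References: [Mazur1978] Cor. 4.1; [GreenbergVatsal2000] §3 Rem. 3.4; [MazurTateTeitelbaum1986] §I.8;
[BreuilConradDiamondTaylor2001] Thm. A; [Miller2011LMS] §1, Def. 1.1; [SilvermanATAEC1994] Cor. IV.9.2 (d);
[Wuthrich2014] Thm. 1, Thm. 4, Cor. 7 (doi:10.4171/dm/450, pp. 382, 384, 386 — the isogeny-class form, not needed here);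
[Kim2022StructureSelmer] §1.4.1.
-/

set_option linter.dupNamespace false
set_option autoImplicit false

noncomputable section

open scoped Classical NumberField MatrixGroups ModularForm

open CongruenceSubgroup WeierstrassCurve Field IsDedekindDomain
  Literature.NumberTheory.EllipticCurves
  Literature.NumberTheory.EllipticCurves.ModularForms
  Literature.NumberTheory.EllipticCurves.Rank1Residual
  Literature.NumberTheory.EllipticCurves.Rank1Residual.Typed
  Literature.NumberTheory.EllipticCurves.Wuthrich2014
  Literature.NumberTheory.GaloisRepresentations
  Summit.BirchSwinnertonDyer.Rank1Residual

/-! ### §1 Arithmetic helper -/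

namespace Summit.BirchSwinnertonDyer.BirchSwinnertonDyer.Theorems.GL1Cartan

/-- A nonzero rational number which is a `p`-adic integer (`‖q‖_p ≤ 1`) has `0 ≤ ord_p q`: its reduced
denominator is prime to `p` (`not_dvd_den_of_norm_ratCast_le_one`) and `ord_p q = ord_p num − ord_p den`.
[folklore] -/
theorem padicValRat_nonneg_of_norm_ratCast_le_one {p : ℕ} [Fact p.Prime] {q : ℚ}
    (h : ‖(q : ℚ_[p])‖ ≤ 1) : 0 ≤ padicValRat p q := by
  have hden : ¬ p ∣ q.den := not_dvd_den_of_norm_ratCast_le_one h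
  rw [padicValRat_def, padicValNat.eq_zero_of_not_dvd hden, Nat.cast_zero, sub_zero]
  exact_mod_cast Nat.zero_le _

end Summit.BirchSwinnertonDyer.BirchSwinnertonDyer.Theorems.GL1Cartan

/-! ### §2 Per pair on X11a: `L(E,1)/Ω_E` is a nonzero rational `p`-adic integer (modularity + Mazur) -/

namespace Summit.BirchSwinnertonDyer.Rank1Residual

section PerPair

variable {W : WeierstrassCurve ℚ} [W.IsElliptic] [W.IsGloballyMinimal] {p : ℕ} [Fact p.Prime]

/-- **`L(E,1)/Ω_E ∈ ℤ_(p) ∖ {0}` at an X11a pair with `p ≥ 5`, granted a period comparison at the pair.**  If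
`Ω(W) = u · Ω⁺_f` with `u ∈ ℚ`, `|u|_p = 1` for the newform `f` of `W`, then `L(E,1)/Ω(W) = [0]⁺_f / u =: t`
is rational, nonzero (`r_an = 0` and modularity `hmod`: `L(E,1) ≠ 0`) and `0 ≤ ord_p t`
(`‖[0]⁺_f‖_p ≤ 1`: `p` odd, `E[p]` irreducible, `IsNewformOf.norm_ratPlusSymbol_le_one`).
[cite: MazurTateTeitelbaum1986, §I.8] [cite: GreenbergVatsal2000, §3, Remark 3.4] -/
theorem ClassX11a.exists_LOne_div_realPeriod_eq_of_periodUnitAt (hmod : hasEntireLFunction_rat)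
    (hX : ClassX11a W p) {N : ℕ} [NeZero N] {f : CuspForm (Gamma0 N) 2} (hf : IsNewformOf W f)
    {u : ℚ} (hu : ‖(u : ℚ_[p])‖ = 1) (hΩ : W.realPeriodRat = u * plusPeriod f) :
    ∃ t : ℚ, W.entireLFunction 1 / (W.realPeriodRat : ℂ) = (t : ℂ) ∧ t ≠ 0 ∧ 0 ≤ padicValRat p t := by
  have hL1 : W.entireLFunction 1 ≠ 0 := hX.L_one_ne_zero hmod
  have hΩpos : 0 < W.realPeriodRat := W.realPeriodRat_pos_holds
  have hΩC : (W.realPeriodRat : ℂ) ≠ 0 := Complex.ofReal_ne_zero.mpr hΩpos.ne'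
  have hu0 : u ≠ 0 := by
    rintro rfl
    rw [Rat.cast_zero, zero_mul] at hΩ
    exact hΩpos.ne' hΩ
  -- `L(E,1) = [0]⁺_f · Ω⁺_f` and `Ω⁺_f = Ω(W)/u`
  have hLval : W.entireLFunction 1 = ((((ratPlusSymbol f 0 : ℚ) : ℝ) * plusPeriod f : ℝ) : ℂ) :=
    hf.entireLFunction_one_eq
  have hplus : plusPeriod f = W.realPeriodRat / u := by
    rw [hΩ, mul_div_cancel_left₀ _ (Rat.cast_ne_zero.mpr hu0)]
  have ht : W.entireLFunction 1 / (W.realPeriodRat : ℂ) = ((ratPlusSymbol f 0 / u : ℚ) : ℂ) := by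
    rw [hLval, hplus, div_eq_iff hΩC]
    push_cast
    have huC : ((u : ℝ) : ℂ) ≠ 0 := by exact_mod_cast hu0
    field_simp
  have hb0 : ratPlusSymbol f 0 ≠ 0 := by
    intro h0
    apply hL1
    rw [hLval, h0]
    simp
  refine ⟨ratPlusSymbol f 0 / u, ht, div_ne_zero hb0 hu0, ?_⟩
  have hb : 0 ≤ padicValRat p (ratPlusSymbol f 0) :=
    BirchSwinnertonDyer.Theorems.GL1Cartan.padicValRat_nonneg_of_norm_ratCast_le_one
      (hf.norm_ratPlusSymbol_le_one hX.ne_two hX.irr (x := 0) (by simp))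
  rw [padicValRat.div hb0 hu0, Rank1Residual.padicValRat_eq_zero_of_norm_ratCast_eq_one hu, sub_zero]
  exact hb

/-- **`L(E,1)/Ω_E ∈ ℤ_(p) ∖ {0}` at every X11a pair with `p ≥ 5`, from modularity (`hnf`) and Mazur 1978 Cor. 4.1
(`hMz`)**: the newform `f` of `W` exists (`exists_isNewformOf`), and at the multiplicative prime `p ≥ 5` with `E[p]`
irreducible `Ω(W) = u · Ω⁺_f` with `|u|_p = 1` (`realPeriodRat_eq_unit_mul_plusPeriod_of_multiplicative_of_mazur`:
Manin constant of the strong Weil curve prime to `p` as `p² ∤ N`, Néron lattices in the `p′`-isogeny class differ by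
`p′`-indices). [cite: Mazur1978, Cor. 4.1] [cite: GreenbergVatsal2000, §3, Remark 3.4] [cite: MazurTateTeitelbaum1986, §I.8] -/
theorem ClassX11a.exists_LOne_div_realPeriod_eq_of_mazur (hnf : exists_isNewformOf)
    (hMz : mazur_not_dvd_maninConstant_of_odd) (hX : ClassX11a W p) (hp5 : 5 ≤ p) :
    ∃ t : ℚ, W.entireLFunction 1 / (W.realPeriodRat : ℂ) = (t : ℂ) ∧ t ≠ 0 ∧ 0 ≤ padicValRat p t := by
  haveI : NeZero (W.conductorNorm ℤ) := ⟨(W.conductorNorm_pos_holds).ne'⟩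
  obtain ⟨f, hf⟩ := hnf W
  obtain ⟨u, hu, hΩ⟩ :=
    SkinnerUrban2014.realPeriodRat_eq_unit_mul_plusPeriod_of_multiplicative_of_mazur hMz W p hp5 hX.mult hX.irr f hf
  exact hX.exists_LOne_div_realPeriod_eq_of_periodUnitAt
    (WeierstrassCurve.hasEntireLFunction_rat_of_exists_isNewformOf hnf) hf hu hΩ

end PerPair

/-- **`ord_p #Ш_an ≥ 0` for `p ≥ 5` and no split multiplicative prime, from `L(E,1)/Ω_E = t ≠ 0` with
`0 ≤ ord_p t`** (class-free; Gross–Zagier–Kolyvagin `hGZK` for `Reg = 1`, `E(ℚ) = E(ℚ)_tors`): `#Ш_an = t · #E(ℚ)² / ∏ c_ℓ`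
(`Wuthrich2014.shaAn_eq_of_L_one_div_eq`) and `p ∤ ∏ c_ℓ` (`X11b.not_dvd_tamagawaProduct_of_forall_split`, vacuously:
no split multiplicative prime). [cite: Miller2011LMS, §1 and Def. 1.1 (arXiv:1010.2431 p. 3)]
[cite: SilvermanATAEC1994, Cor. IV.9.2 (d)] -/
theorem exists_shaAn_eq_padicValRat_nonneg_of_LOne_div
    (hGZK : rank_eq_analyticRank_of_analyticRank_le_one)
    (W : WeierstrassCurve ℚ) [W.IsElliptic] [W.IsGloballyMinimal] (p : ℕ) [Fact p.Prime] (hp5 : 5 ≤ p)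
    (hns : ∀ (ℓ : ℕ) [Fact ℓ.Prime], ¬ W.HasSplitMultiplicativeReductionAtPrime ℓ)
    {t : ℚ} (ht : W.entireLFunction 1 / (W.realPeriodRat : ℂ) = (t : ℂ)) (ht0 : t ≠ 0)
    (hvt : 0 ≤ padicValRat p t) :
    ∃ q : ℚ, shaAn W = (q : ℂ) ∧ 0 ≤ padicValRat p q := by
  have hΩC : (W.realPeriodRat : ℂ) ≠ 0 := Complex.ofReal_ne_zero.mpr W.realPeriodRat_pos_holds.ne'
  have hL1 : W.entireLFunction 1 ≠ 0 := by
    intro h0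
    apply ht0
    have h : ((t : ℚ) : ℂ) = 0 := by rw [← ht, h0, zero_div]
    exact_mod_cast h
  obtain ⟨-, hE, -, hsha⟩ := shaAn_eq_of_L_one_div_eq hGZK W hL1 ht
  haveI := hE
  refine ⟨_, hsha, ?_⟩
  have hp : p.Prime := Fact.out
  have htam : ¬ p ∣ W.tamagawaProduct :=
    X11b.not_dvd_tamagawaProduct_of_forall_split W hp hp5 (fun ℓ _ hs => absurd hs (hns ℓ))
  have hcard0 : (Nat.card W.toAffine.Point : ℚ) ≠ 0 := by
    exact_mod_cast (Nat.card_pos (α := W.toAffine.Point)).ne'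
  have htam0 : (W.tamagawaProduct : ℚ) ≠ 0 := by
    exact_mod_cast (W.tamagawaProduct_pos_holds : 0 < W.tamagawaProduct).ne'
  have hc : 0 ≤ padicValRat p (Nat.card W.toAffine.Point : ℚ) := by
    rw [padicValRat.of_nat]
    exact_mod_cast Nat.zero_le _
  have htamv : padicValRat p (W.tamagawaProduct : ℚ) = 0 := by
    rw [padicValRat.of_nat, padicValNat.eq_zero_of_not_dvd htam, Nat.cast_zero]
  rw [padicValRat.div (mul_ne_zero ht0 (pow_ne_zero 2 hcard0)) htam0,
    padicValRat.mul ht0 (pow_ne_zero 2 hcard0), padicValRat.pow, htamv, sub_zero, Nat.cast_ofNat]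
  linarith

end Summit.BirchSwinnertonDyer.Rank1Residual

/-! ### §3 The bridge: stub I `ShaAnIntegral` (unfolded verbatim) from three existing named facts -/

namespace Summit.BirchSwinnertonDyer.BirchSwinnertonDyer.Theorems.GL1Cartan

/-- **Stub I of line «gl1cartan5» from modularity, Mazur 1978 Cor. 4.1 and Gross–Zagier–Kolyvagin, BY NAME.**  The
conclusion is `Cruxes.UpperNonSurjFive.GL1Cartan.ShaAnIntegral` unfolded verbatim: at every X11a pair `(W, p)` with
`5 ≤ p` and no split multiplicative prime, `#Ш(E/ℚ)_an` is a rational number of non-negative `p`-adic valuation.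
Road: `#Ш_an = ([0]⁺_f / u) · #E(ℚ)² / ∏ c_ℓ` with `[0]⁺_f ∈ ℤ_(p)` (`E[p]` irreducible, `p` odd), `|u|_p = 1`
(Néron period vs. `Ω⁺_f` at the multiplicative prime `p ≥ 5`: Mazur's Manin constant + `p′`-isogeny class),
`p ∤ ∏ c_ℓ` (Kodaira–Néron, no split multiplicative prime, `p ≥ 5`).  No Wuthrich 2014 Thm. 1 / Cor. 7 fact is
needed (their isogeny-class statement is subsumed, for `E[p]` irreducible, by the tree's period comparison).
[cite: Mazur1978, Cor. 4.1] [cite: GreenbergVatsal2000, §3, Remark 3.4] [cite: MazurTateTeitelbaum1986, §I.8]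
[cite: Miller2011LMS, Def. 1.1 (arXiv:1010.2431 p. 3)] [cite: SilvermanATAEC1994, Cor. IV.9.2 (d)] -/
theorem shaAnIntegral_of_mazur (hnf : exists_isNewformOf) (hMz : mazur_not_dvd_maninConstant_of_odd)
    (hGZK : rank_eq_analyticRank_of_analyticRank_le_one) :
    ∀ (W : WeierstrassCurve ℚ) [W.IsElliptic] [W.IsGloballyMinimal] (p : ℕ) [Fact p.Prime],
      ClassX11a W p → 5 ≤ p → (∀ (ℓ : ℕ) [Fact ℓ.Prime], ¬ W.HasSplitMultiplicativeReductionAtPrime ℓ) →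
      ∃ q : ℚ, shaAn W = (q : ℂ) ∧ 0 ≤ padicValRat p q := by
  intro W _ _ p _ hX hp5 hns
  obtain ⟨t, ht, ht0, hvt⟩ := hX.exists_LOne_div_realPeriod_eq_of_mazur hnf hMz hp5
  exact exists_shaAn_eq_padicValRat_nonneg_of_LOne_div hGZK W p hp5 hns ht ht0 hvt

/-- **The same bridge with the Greenberg–Vatsal period comparison in place of Mazur**: stub I from `exists_isNewformOf`,
`realPeriodRat_eq_unit_mul_plusPeriod_of_multiplicative` (`Ω_E = u·Ω⁺_f`, `|u|_p = 1` at a multiplicative `p ≥ 5`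
with `E[p]` irreducible) and Gross–Zagier–Kolyvagin. [cite: GreenbergVatsal2000, §3, Remark 3.4]
[cite: MazurTateTeitelbaum1986, §I.8] [cite: Miller2011LMS, Def. 1.1 (arXiv:1010.2431 p. 3)] -/
theorem shaAnIntegral_of_periodUnit (hnf : exists_isNewformOf)
    (hper : realPeriodRat_eq_unit_mul_plusPeriod_of_multiplicative)
    (hGZK : rank_eq_analyticRank_of_analyticRank_le_one) :
    ∀ (W : WeierstrassCurve ℚ) [W.IsElliptic] [W.IsGloballyMinimal] (p : ℕ) [Fact p.Prime],
      ClassX11a W p → 5 ≤ p → (∀ (ℓ : ℕ) [Fact ℓ.Prime], ¬ W.HasSplitMultiplicativeReductionAtPrime ℓ) →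
      ∃ q : ℚ, shaAn W = (q : ℂ) ∧ 0 ≤ padicValRat p q := by
  intro W _ _ p _ hX hp5 hns
  haveI : NeZero (W.conductorNorm ℤ) := ⟨(W.conductorNorm_pos_holds).ne'⟩
  obtain ⟨f, hf⟩ := hnf W
  obtain ⟨u, hu, hΩ⟩ := hper W p hp5 hX.mult hX.irr f hf
  obtain ⟨t, ht, ht0, hvt⟩ := hX.exists_LOne_div_realPeriod_eq_of_periodUnitAt
    (WeierstrassCurve.hasEntireLFunction_rat_of_exists_isNewformOf hnf) hf hu hΩ
  exact exists_shaAn_eq_padicValRat_nonneg_of_LOne_div hGZK W p hp5 hns ht ht0 hvt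

end Summit.BirchSwinnertonDyer.BirchSwinnertonDyer.Theorems.GL1Cartan

end
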